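/-
Copyright (c) 2026 the pub-hodgecm-mathlib formalisation cell (harness21).  R90-TF SLAB, section S10 (Rogawski 1990, §13.8 Prop. 13.8.3 read at `v`),
prover K2Liu-p26 (g4) — DEAL #97 «the `hPS♭` ASSEMBLY at `w ≠ v`» (S10 dealer R90-C138-plan (g4), 2026-09-05T03:46Z): the keystone road's shrunk PS-realisation binder `hPS♭`
(★ p865075 `exists_eigenvaluePackage_hexFamily_of_levelTraces`) discharged MODULO the one named local letter `hSat` («Satake parameter exists»); h413 = `stmt-HodgeConjecture-24833`,
route `HCCMUnconditional`.
-/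
import Summits.HodgeConjecture.HodgeConjecture.Theorems.R90S10HexOfLevelTraces             -- ★ p865075 (K2Liu-p13): (b3) `levelTrace_eq_of_common_sphericalConstituent`, (H2♭) `exists_eigenvaluePackage_hexFamily_of_levelTraces` (the `hPS♭` binder), ★ `S10FrozenDatum`
import Summits.HodgeConjecture.HodgeConjecture.Theorems.R90S10SphericalConstituentOfFrozen  -- ★ p865188 (this seat): §1 `finrank_fixedPoints_rho_eq_one`, §3 (b2)♭ `exists_sphericalConstituent_cmPrincipalSeriesH_of_satake`
import Summits.HodgeConjecture.HodgeConjecture.Theorems.R90S10FrozenLineVectorNeZero        -- ★ p865109 (K2E5-p16): (b1) `S10HDatum.x₀_ne_zero`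
import HarnessLib

/-!
# R90-TF ∕ S10 — THE `hPS♭` ASSEMBLY AT `w ≠ v`: the keystone's level-trace letter from (b1) + (b2)♭ + (b3), modulo «Satake parameter exists»
# (`Theorems/R90S10HPSFlatOfSatake.lean`; ns `Summit.HodgeConjecture.HodgeConjecture.R90.S10`; THEOREMS ONLY — no `def`, no instance, no notation, no named fact, no `sorry`;
# LAW L9: ★ `Theorems` ∕ `Literature` imports only)

Print: [Rogawski1990] §13.8 Prop. 13.8.3 (proof) p. 218 L9 (ii) «`ρ_w` unramified for all finite `w ≠ v`», p. 219 L2–L3 «since `ρ_v` is unramified for finite `v ≠ w`, `π_v = ξ_H(ρ_v)`»;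
§12.1 pp. 171–172 (the principal series `i_H(χ)` of `H = U(2) × U(1)`), §12.2 pp. 173–174; [CartierCorvallis1979] §IV.1 Thm. 4.1, Cor. 4.1–4.2 (unramified irreducible admissible
representations ↔ characters of `ℋ(G, K)`); [BorelJacquet1979] §4.4.

## WHY (row 6 of FILE D; dealer (g4) DEAL #69 road (b) → #71 (R11) → #97)
The keystone ★ `sock₂Sig_of_inputs` (p07) reads its `t₀`∕`hex` binders through (H2♭) ★ `exists_eigenvaluePackage_hexFamily_of_levelTraces (hunr) (hμω) (𝔣) (hPS♭)` (K2Liu-p13, ★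
p865075), whose binder `hPS♭` is the print-true LEVEL-TRACE letter: at every `w ≠ v` some principal series `i_H(χ₂ ⊠ χ₁)` (`χ₁` smooth, a `K_{H,w}`-line) has THE SAME
`K_{H,w}`-LEVEL TRACES as `ρ_w`.  THIS FILE pays `hPS♭` from the three ★ bricks of its discharge — (b1) ★ `S10HDatum.x₀_ne_zero` (K2E5-p16: the distinguished vector is non-zero off
`v`, so `dim ρ_w^{K_H} = 1`, ★ `finrank_fixedPoints_rho_eq_one`), (b2)♭ ★ `exists_sphericalConstituent_cmPrincipalSeriesH_of_satake` (this seat: the `K_H`-spherical constituent `r` of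
`ρ_w` is a constituent of some `i_H(χ₂ ⊠ χ₁)`, modulo `hSat`), (b3) ★ `levelTrace_eq_of_common_sphericalConstituent` (K2Liu-p13: two admissible `K_H`-line representations sharing a
`K_H`-spherical constituent have the same level-`K_H` traces; admissibility of `i_H(χ₂ ⊠ χ₁)` = ★ `isAdmissible_cmPrincipalSeriesH`) — MODULO `hSat` ONLY, taken per place: `hSat w` =
«some `i_H(χ₂ ⊠ χ₁)` with `χ₁` smooth and a `K_{H,w}`-line has the parameter of `ρ_w` on `ℋ(H_w, K_{H,w})`» (the ★ p865188 §3 binder at `w.1`, with `dim ρ_w^{K_H} = 1` supplied by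
★ (b1) + ★ §1).  `hSat` is [CartierCorvallis1979 §IV.1 Thm. 4.1] at `H_w` for the one parameter of `ρ_w` (Satake surjectivity ∕ the `U(Φ₂)_w` Jacquet criterion; NOT ★ — the tree
carries the `N = 2` criterion only as the hypothesis `hHC₂` of ★ `F0P3bU2PrincipalSeriesHCOfJacquetCriterion`).

## CONTENTS
* `S10FrozenDatum.hPSFlat_of_hSat (𝔣) (hSat)` — THE `hPS♭` BINDER OF ★ p865075 :233ff VERBATIM (∀ `w ≠ v`: `∃ χ₂ χ₁, IsOpen χ₁.ker ∧ dim i_H(χ₂ ⊠ χ₁)^{K_H} = 1 ∧` the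
  level-trace equality against `𝔣.𝔳.νHw w`).
* `S10FrozenDatum.exists_eigenvaluePackage_hexFamily_of_hSat (hunr) (hμω) (𝔣) (hSat)` — the COROLLARY: (H2♭)'s conclusion (the keystone's `t₀`∕`hex` package, `S = {v}`) from
  `hSat` in place of `hPS♭` (★ p865075 ∘ the assembly), so the keystone road's PS-side residual IS `hSat` and nothing else.
HONEST LABEL: ★-level glue (`--supports stmt-HodgeConjecture-24833 --as helper`); discharges `hPS♭` ONLY MODULO the named local letter `hSat` (NOT ★); closes no socket by itself;
HC_CM is proved only modulo the 7 printed citations (2 remaining named inputs: hLiu418 = `stmt-HodgeConjecture-24832`, h413 = `stmt-HodgeConjecture-24833`) until rung 0 closes;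
REL ≠ ★ ≠ BUILT; count-neutral.

## References
* [Rogawski1990] J. D. Rogawski, *Automorphic Representations of Unitary Groups in Three Variables*, Ann. of Math. Stud. 123 (1990), §12.1 pp. 171–172; §12.2 pp. 173–174;
  §13.6 p. 209; §13.8 p. 218 L9, p. 219 L2–L3.
* [CartierCorvallis1979] P. Cartier, *Representations of 𝔭-adic groups: a survey*, Proc. Sympos. Pure Math. 33.1 (1979), §IV.1 Thm. 4.1, Cor. 4.1–4.2.
* [BorelJacquet1979] A. Borel, H. Jacquet, *Automorphic forms and automorphic representations*, Proc. Sympos. Pure Math. 33.1 (1979), §4.4.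
-/

set_option autoImplicit false
set_option linter.dupNamespace false

noncomputable section

open scoped RestrictedProduct Matrix MatrixGroups
open Filter MeasureTheory NumberField IsDedekindDomain CompactlySupported
open Literature.NumberTheory.Rogawski1990 Literature.NumberTheory.Automorphic Literature.NumberTheory.Automorphic.UnitaryGroup
open Literature.NumberTheory.Automorphic.UnitaryGroup.CotangentForms Literature.NumberTheory.GaloisRepresentations
open Literature.NumberTheory.Automorphic.Arthur2013.Leaves.TECR
open Summit.HodgeConjecture.HodgeConjecture.Cruxes.H413
open Summit.HodgeConjecture.HodgeConjecture.Cruxes.H413.K2E1TraceFormulaBeta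
open Summit.HodgeConjecture.HodgeConjecture.Cruxes.H413.K2E1SpectralTermsDiscreteHalf
open Summit.HodgeConjecture.HodgeConjecture.Cruxes.H413.K2E1EigenvaluePackageOfSpherical
open Summit.HodgeConjecture.HodgeConjecture.Cruxes.H413.K2E1EvpOfAutomorphicClass

namespace Summit.HodgeConjecture.HodgeConjecture.R90.S10

section Frozen

variable {L : Type} [Field L] [NumberField L] [IsCMField L] [DecidableEq (Pl L)] {μ : HeckeCharacter L} {v : Pl L}
  [MeasurableSpace (HLoc L v)] [BorelSpace (HLoc L v)] [MeasurableSpace (Gqs L v)] [BorelSpace (Gqs L v)]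
  {νHv : Measure (HLoc L v)} {νQv : Measure (Gqs L v)} [νHv.IsHaarMeasure] [νHv.IsMulRightInvariant] [νQv.IsHaarMeasure] [νQv.IsMulRightInvariant]
  [∀ a : HLoc L v, MeasurableSpace (HLoc L v ⧸ Subgroup.centralizer ({a} : Set (HLoc L v)))]
  [∀ a : HLoc L v, BorelSpace (HLoc L v ⧸ Subgroup.centralizer ({a} : Set (HLoc L v)))]
  [∀ γ : Gqs L v, MeasurableSpace (Gqs L v ⧸ Subgroup.centralizer ({γ} : Set (Gqs L v)))]
  [∀ γ : Gqs L v, BorelSpace (Gqs L v ⧸ Subgroup.centralizer ({γ} : Set (Gqs L v)))]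
  {mHv : OrbitalMeasureFamily (HLoc L v)} {mQv : OrbitalMeasureFamily (Gqs L v)} {πSt : IrrClass (HLoc L v)}
  [MeasurableSpace (G3 L).Adelic] [BorelSpace (G3 L).Adelic] [MeasurableSpace (H2 L).Adelic] [BorelSpace (H2 L).Adelic]
  [MeasurableSpace (GArch L)] [BorelSpace (GArch L)] [MeasurableSpace (HArch L)] [BorelSpace (HArch L)]
  [MeasurableSpace (H1Loc L v)] [MeasurableSpace (H1Arch L)] [MeasurableSpace (H1 L).Adelic] [BorelSpace (H1 L).Adelic]

set_option maxHeartbeats 800000 in -- measured: the final `isDefEq` against the `cmPrincipalSeriesH` level-trace shape exhausts 400000; 800000 passes (cf. ★ p865188 §3)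
/-- **THE `hPS♭` ASSEMBLY AT `w ≠ v`** — for the frozen datum `𝔣` and the letter `hSat` at every `w ≠ v` («some principal series `i_H(χ₂ ⊠ χ₁)` of `H_w` with `χ₁` smooth and a
`K_{H,w}`-line has THE PARAMETER OF `ρ_w` on `ℋ(H_w, K_{H,w})`»; the ★ p865188 §3 binder, `dim ρ_w^{K_H} = 1` by ★ (b1) `x₀_ne_zero` + ★ `finrank_fixedPoints_rho_eq_one`): the
LEVEL-TRACE letter `hPS♭` — the binder of ★ `exists_eigenvaluePackage_hexFamily_of_levelTraces` VERBATIM: at every `w ≠ v` there are `χ₂`, `χ₁` with `IsOpen χ₁.ker`,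
`dim i_H(χ₂ ⊠ χ₁)^{K_{H,w}} = 1`, and `Tr ρ_w(f^H) = Tr i_H(χ₂ ⊠ χ₁)(f^H)` for every locally smooth `f^H` of level `K_{H,w}` (against `𝔣.𝔳.νHw w`).  Proof: (b2)♭ ★
`exists_sphericalConstituent_cmPrincipalSeriesH_of_satake` gives `χ₂ χ₁` and a `K_H`-spherical class `r` in BOTH `ρ_w` and `i_H(χ₂ ⊠ χ₁)`; (b3) ★ `levelTrace_eq_of_common_sphericalConstituent`
(both admissible: ★ field `hadm`, ★ `isAdmissible_cmPrincipalSeriesH`). [cite: Rogawski1990, §13.8 p. 218 L9, p. 219 L2–L3; §12.1 pp. 171–172] [cite: CartierCorvallis1979, §IV.1 Thm. 4.1, Cor. 4.1–4.2]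
[cite: BorelJacquet1979, §4.4] -/
theorem S10FrozenDatum.hPSFlat_of_hSat (𝔣 : S10FrozenDatum L μ v νHv νQv mHv mQv πSt)
    (hSat : ∀ w : {w : Pl L // w ≠ v},
      letI := 𝔣.𝔥.acV w.1
      letI := 𝔣.𝔥.mdV w.1
      ∃ (χ₂ : ↥(torusU (conjLocal L (IsCMField.complexConj L) w.1) (cmLocalForm L 2 w.1)) →* ℂˣ) (χ₁ : H1Loc L w.1 →* ℂˣ),
        IsOpen ((χ₁.ker : Subgroup (H1Loc L w.1)) : Set (H1Loc L w.1)) ∧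
          ∃ hlineP : Module.finrank ℂ ↥((cmPrincipalSeriesH L w.1 χ₂ χ₁).fixedPoints (𝔣.𝔥.KH w.1)) = 1,
            unopSphericalCharacter (𝔣.𝔥.KH w.1) (cmPrincipalSeriesH L w.1 χ₂ χ₁) hlineP =
              unopSphericalCharacter (𝔣.𝔥.KH w.1) (𝔣.𝔥.ρ w.1) (𝔣.𝔥.finrank_fixedPoints_rho_eq_one w.2 (S10HDatum.x₀_ne_zero L μ v νHv νQv mHv mQv πSt 𝔣.𝔥 w.1 w.2))) :
    ∀ w : {w : Pl L // w ≠ v}, ∃ (χ₂ : ↥(torusU (conjLocal L (IsCMField.complexConj L) w.1) (cmLocalForm L 2 w.1)) →* ℂˣ) (χ₁ : H1Loc L w.1 →* ℂˣ),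
      IsOpen ((χ₁.ker : Subgroup (H1Loc L w.1)) : Set (H1Loc L w.1)) ∧
        Module.finrank ℂ ↥((cmPrincipalSeriesH L w.1 χ₂ χ₁).fixedPoints (𝔣.𝔥.KH w.1)) = 1 ∧
          (letI := 𝔣.𝔥.acV w.1
           letI := 𝔣.𝔥.mdV w.1
           letI := 𝔣.𝔳.msH w
           ∀ fH : HLoc L w.1 → ℂ, IsLocSmooth fH → IsLevel (𝔣.𝔥.KH w.1) fH →
             (𝔣.𝔥.ρ w.1).smoothTrace (𝔣.𝔳.νHw w) fH = (cmPrincipalSeriesH L w.1 χ₂ χ₁).smoothTrace (𝔣.𝔳.νHw w) fH) := by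
  intro w
  letI := 𝔣.𝔥.acV w.1
  letI := 𝔣.𝔥.mdV w.1
  letI := 𝔣.𝔳.msH w
  haveI := 𝔣.𝔳.bsH w
  haveI := 𝔣.𝔳.hνHw w
  have hline1 : Module.finrank ℂ ↥((𝔣.𝔥.ρ w.1).fixedPoints (𝔣.𝔥.KH w.1)) = 1 :=
    𝔣.𝔥.finrank_fixedPoints_rho_eq_one w.2 (S10HDatum.x₀_ne_zero L μ v νHv νQv mHv mQv πSt 𝔣.𝔥 w.1 w.2)
  -- (b2)♭: the common `K_H`-spherical constituent of `ρ_w` and of some `i_H(χ₂ ⊠ χ₁)`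
  obtain ⟨χ₂, χ₁, r, hχ₁, hlineP, -, hsph, hr, hrP⟩ :=
    𝔣.𝔥.exists_sphericalConstituent_cmPrincipalSeriesH_of_satake w.1 (𝔣.𝔳.νHw w) hline1 (hSat w)
  -- (b3): two admissible `K_H`-lines sharing a spherical constituent have the same level traces
  refine ⟨χ₂, χ₁, hχ₁, hlineP, fun fH hf hfK => ?_⟩
  exact levelTrace_eq_of_common_sphericalConstituent (𝔣.𝔳.νHw w) (𝔣.𝔥.hadm w.1) hline1 (isAdmissible_cmPrincipalSeriesH L w.1 χ₂ χ₁ hχ₁) hlineP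
    hsph hr hrP hf hfK

/-- **COROLLARY — THE KEYSTONE'S `t₀`∕`hex` PACKAGE (`S = {v}`) FROM `hSat`**: (H2♭) ★ `exists_eigenvaluePackage_hexFamily_of_levelTraces` fed with the assembled `hPS♭`; so on
the keystone road (⟪U⟫ off `v`, `μ|_{𝕀_{L⁺}} = ω`) the PS-side residual is EXACTLY the named local letter `hSat`. [cite: Rogawski1990, §13.8 p. 219 L2–L3; §13.6 p. 209; §12.1 p. 171]
[cite: CartierCorvallis1979, §IV.1 Thm. 4.1, Cor. 4.1–4.2] -/
theorem S10FrozenDatum.exists_eigenvaluePackage_hexFamily_of_hSat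
    (hunr : ∀ w : Pl L, w ≠ v → ∀ W : PlacesOver L w, Algebra.IsUnramifiedAt (𝓞 ↥(maximalRealSubfield L)) W.1.asIdeal ∧ μ.IsUnramifiedAt W.1)
    (hμω : ∀ x : Literature.NumberTheory.GaloisRepresentations.ideleGroup ↥(maximalRealSubfield L),
      μ (AdeleRing.ideleBaseChange (↥(maximalRealSubfield L)) L x) = quadraticHeckeCharCM L x)
    (𝔣 : S10FrozenDatum L μ v νHv νQv mHv mQv πSt)
    (hSat : ∀ w : {w : Pl L // w ≠ v},
      letI := 𝔣.𝔥.acV w.1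
      letI := 𝔣.𝔥.mdV w.1
      ∃ (χ₂ : ↥(torusU (conjLocal L (IsCMField.complexConj L) w.1) (cmLocalForm L 2 w.1)) →* ℂˣ) (χ₁ : H1Loc L w.1 →* ℂˣ),
        IsOpen ((χ₁.ker : Subgroup (H1Loc L w.1)) : Set (H1Loc L w.1)) ∧
          ∃ hlineP : Module.finrank ℂ ↥((cmPrincipalSeriesH L w.1 χ₂ χ₁).fixedPoints (𝔣.𝔥.KH w.1)) = 1,
            unopSphericalCharacter (𝔣.𝔥.KH w.1) (cmPrincipalSeriesH L w.1 χ₂ χ₁) hlineP =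
              unopSphericalCharacter (𝔣.𝔥.KH w.1) (𝔣.𝔥.ρ w.1) (𝔣.𝔥.finrank_fixedPoints_rho_eq_one w.2 (S10HDatum.x₀_ne_zero L μ v νHv νQv mHv mQv πSt 𝔣.𝔥 w.1 w.2))) :
    ∃ t₀ : Ch13Sec6.EigenvaluePackage ({v} : Set (Pl L)) fun w => heckeAlgebra ℂ (Gqs L w) (cmLocalIntegralLevel L 3 (qsForm L) w),
      ∀ w : {w : Pl L // w ≠ v}, ∃ π₀ : IrrClass (Gqs L w.1), π₀.IsAdmissible ∧ ∃ h₀ : π₀.IsSpherical (cmLocalIntegralLevel L 3 (qsForm L) w.1),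
        unopClassSphericalCharacter (cmLocalIntegralLevel L 3 (qsForm L) w.1) π₀ h₀ = t₀ ⟨w.1, fun h => w.2 (Set.mem_singleton_iff.1 h)⟩ ∧
          LiesOver L μ w.1 (𝔣.𝔳.K w.1) (𝔣.𝔥.KH w.1) (𝔣.𝔳.νQ w) (𝔣.𝔳.νHw w) (𝔣.𝔳.mH w) (𝔣.𝔳.mQ w) π₀ (𝔣.𝔥.ρ w.1) :=
  exists_eigenvaluePackage_hexFamily_of_levelTraces hunr hμω 𝔣 (𝔣.hPSFlat_of_hSat hSat)

end Frozen

end Summit.HodgeConjecture.HodgeConjecture.R90.S10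

end
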